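import Summits.HubbardSuperconductivity.HubbardSuperconductivity.Theorems.AnisotropyChordInsertionEntropyJastrowParticleHole
import Summits.HubbardSuperconductivity.HubbardSuperconductivity.Theorems.AnisotropyChordInsertionEntropyFourier
import Summits.HubbardSuperconductivity.HubbardSuperconductivity.Theorems.AnisotropyChordInsertionEntropySheetFluctuation

/-!
# Route `AnisotropyChord` / H0 rotor rung: BOSE–EINSTEIN CONDENSATION OF THE HALF-FILLED COULOMB-SHEET JASTROW STATE
# AT EVERY COUPLING — UNCONDITIONAL (instance of the kernel-generic resampling route; recommended by theory seat
# `hubbard-h0-rotor-theory-1`, memo ROTOR-THEORY-9 §135(t) «with the periodised kernel … the theorem would be UNCONDITIONAL»)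

The PERIODIC (spectral) Coulomb-sheet kernel on the discrete torus `Λ = (ℤ/L)²`:
`V_L(z) = L⁻² Σ_{k ≠ 0} (2π/|k|_T) cos(k·z)` — the lattice Green's function with Fourier multiplier `2π/|k|_T`, i.e.
the 3D Coulomb interaction restricted to a periodic 2D sheet (structure factor class `S(k) ≍ |k|`); its Fourier
coefficients are non-negative BY CONSTRUCTION, so positive-semidefiniteness is Parseval, with no lattice-sum
certification.  The Jastrow kernel is `W_L = β (V_L + V_L(0))` off the diagonal, `W_L(0) = 0` (the constant shift
`β V_L(0)` only makes `W_L ≥ 0`; on the canonical `N`-sector it changes the state by nothing).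
* `coulombSheetWeight`, `coulombSheetRaw` (`V_L`), `coulombSheetMass` (`V_L(0) ≤ 25`, tree lattice sum
  `sum_rpow_neg_torusNorm_le` with `α = 1`), `coulombSheetRaw_psd` (Parseval), `coulombSheetKernel` (`W_L`) with
  `0 ≤ W_L ≤ 50β`, even, `W_L 0 = 0`, `KernelPSDShift W_L (50β)`;
* **`condensateDensity_coulombSheet_ge` / `_even` (UNCONDITIONAL):** for every `β ≥ 0` and every even `L ≥ 2`,
  the canonical half-filled Jastrow / Rokhsar–Kivelson state `jAmp (coulombSheetKernel L β) (L²/2)` has condensate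
  density `n₀/|Λ| ≥ e^{−C(β)/2}/4` with `C(β) = resamplingConst (50β) (50β)` INDEPENDENT of `L`:
  off-diagonal long-range order of a 2D hard-core lattice Bose wavefunction with unscreened `1/r`-type Jastrow
  correlations, RP-free, at zero temperature.
-/

set_option linter.dupNamespace false

noncomputable section

open Finset Complex
open scoped ComplexConjugate
open Literature.Probability.LatticeModels

namespace Summit.HubbardSuperconductivity.HubbardSuperconductivity.Theorems.AnisotropyChord.InsertionEntropy

section CoulombSheet

/-- Fourier weights of the periodic Coulomb-sheet kernel: `c_k = 2π/|k|_T` for `k ≠ 0`, `c_0 = 0`. [folklore] -/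
def coulombSheetWeight (L : ℕ) [NeZero L] (k : TorusSite 2 L) : ℝ :=
  if k = 0 then 0 else 2 * Real.pi / torusNorm L k

/-- The periodic (spectral) Coulomb-sheet kernel `V_L(z) = L⁻² Σ_k c_k Re φ_k(z)`. [folklore] -/
def coulombSheetRaw (L : ℕ) [NeZero L] (z : TorusSite 2 L) : ℝ :=
  (∑ k, coulombSheetWeight L k * (torusPhase L k z).re) / (L : ℝ) ^ 2

/-- `V_L(0) = L⁻² Σ_k c_k`. [folklore] -/
def coulombSheetMass (L : ℕ) [NeZero L] : ℝ := (∑ k, coulombSheetWeight L k) / (L : ℝ) ^ 2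

/-- The Coulomb-sheet JASTROW kernel: `W_L(0) = 0`, `W_L(z) = β (V_L(z) + V_L(0))` for `z ≠ 0`. [folklore] -/
def coulombSheetKernel (L : ℕ) [NeZero L] (β : ℝ) (z : TorusSite 2 L) : ℝ :=
  if z = 0 then 0 else β * (coulombSheetRaw L z + coulombSheetMass L)

variable {L : ℕ} [NeZero L]

/-- `c_k ≥ 0`. [folklore] -/
theorem coulombSheetWeight_nonneg (k : TorusSite 2 L) : 0 ≤ coulombSheetWeight L k := by
  unfold coulombSheetWeight
  split_ifs with hk
  · exact le_rfl
  · exact div_nonneg (by positivity) (torusNorm_nonneg k)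

/-- `V_L(0) ≥ 0`. [folklore] -/
theorem coulombSheetMass_nonneg : 0 ≤ coulombSheetMass L :=
  div_nonneg (Finset.sum_nonneg fun k _ => coulombSheetWeight_nonneg k) (sq_nonneg _)

/-- `V_L(0) = L⁻² Σ_k c_k`. [folklore] -/
theorem coulombSheetRaw_zero : coulombSheetRaw L 0 = coulombSheetMass L := by
  unfold coulombSheetRaw coulombSheetMass
  congr 1
  exact Finset.sum_congr rfl fun k _ => by rw [torusPhase_zero_right, Complex.one_re, mul_one]

/-- `|V_L(z)| ≤ V_L(0)`. [folklore] -/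
theorem abs_coulombSheetRaw_le (z : TorusSite 2 L) : |coulombSheetRaw L z| ≤ coulombSheetMass L := by
  unfold coulombSheetRaw coulombSheetMass
  rw [abs_div, abs_of_nonneg (sq_nonneg (L : ℝ))]
  refine div_le_div_of_nonneg_right ?_ (sq_nonneg _)
  refine (Finset.abs_sum_le_sum_abs _ _).trans (Finset.sum_le_sum fun k _ => ?_)
  rw [abs_mul, abs_of_nonneg (coulombSheetWeight_nonneg k)]
  refine mul_le_of_le_one_right (coulombSheetWeight_nonneg k) ?_
  exact (Complex.abs_re_le_norm _).trans (le_of_eq (norm_torusPhase k z))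

/-- `V_L` is even. [folklore] -/
theorem coulombSheetRaw_neg (z : TorusSite 2 L) : coulombSheetRaw L (-z) = coulombSheetRaw L z := by
  unfold coulombSheetRaw
  congr 1
  exact Finset.sum_congr rfl fun k _ => by rw [torusPhase_neg_right, Complex.conj_re]

/-- **`V_L(0) ≤ 25` uniformly in `L`** (the tree's lattice sum `Σ_{k≠0} |k|_T^{−1} ≤ (2π)^{−1}·25·L²`). [folklore] -/
theorem coulombSheetMass_le : coulombSheetMass L ≤ 25 := by
  have hL : (0 : ℝ) < (L : ℝ) := by exact_mod_cast Nat.pos_of_ne_zero (NeZero.ne L)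
  have hL2 : (0 : ℝ) < (L : ℝ) ^ 2 := by positivity
  have hsum : ∑ k, coulombSheetWeight L k
      = 2 * Real.pi * ∑ k ∈ Finset.univ.filter (fun k : TorusSite 2 L => k ≠ 0), (torusNorm L k) ^ (-(1 : ℝ)) := by
    rw [Finset.mul_sum, Finset.sum_filter]
    refine Finset.sum_congr rfl fun k _ => ?_
    unfold coulombSheetWeight
    by_cases hk : k = 0
    · rw [if_pos hk, if_neg (not_not.mpr hk)]
    · rw [if_neg hk, if_pos hk, Real.rpow_neg_one, div_eq_mul_inv]
  have hlat := sum_rpow_neg_torusNorm_le (L := L) (α := 1) zero_le_one (by norm_num)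
  have hc : (2 * Real.pi) ^ (-(1 : ℝ)) * (1 + 2 / (1 - (1 : ℝ) / 2)) ^ 2 = 25 / (2 * Real.pi) := by
    rw [Real.rpow_neg_one]; norm_num; ring
  rw [hc] at hlat
  unfold coulombSheetMass
  rw [div_le_iff₀ hL2, hsum]
  have hpi : 0 < 2 * Real.pi := by positivity
  calc 2 * Real.pi * ∑ k ∈ Finset.univ.filter (fun k : TorusSite 2 L => k ≠ 0), (torusNorm L k) ^ (-(1 : ℝ))
      ≤ 2 * Real.pi * (25 / (2 * Real.pi) * (L : ℝ) ^ 2) := mul_le_mul_of_nonneg_left hlat hpi.le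
    _ = 25 * (L : ℝ) ^ 2 := by field_simp

/-- **`V_L` is positive semidefinite (Parseval):** `Σ_{u,v} f_u f_v V_L(u−v) = L⁻² Σ_k c_k |Σ_u f_u φ_k(u)|² ≥ 0`. [folklore] -/
theorem coulombSheetRaw_psd (f : TorusSite 2 L → ℝ) : 0 ≤ ∑ u, ∑ v, f u * f v * coulombSheetRaw L (u - v) := by
  set F : TorusSite 2 L → ℂ := fun k => ∑ u, (f u : ℂ) * torusPhase L k u with hF
  have key : ∀ k, ∑ u, ∑ v, f u * f v * (torusPhase L k (u - v)).re = Complex.normSq (F k) := by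
    intro k
    have h1 : F k * conj (F k) = ∑ u, ∑ v, ((f u * f v : ℝ) : ℂ) * torusPhase L k (u - v) := by
      rw [hF]
      simp only [map_sum, map_mul, Complex.conj_ofReal, Finset.sum_mul, Finset.mul_sum]
      rw [Finset.sum_comm]
      refine Finset.sum_congr rfl fun u _ => Finset.sum_congr rfl fun v _ => ?_
      rw [torusPhase_sub_right]; push_cast; ring
    have h2 : (F k * conj (F k)).re = Complex.normSq (F k) := by rw [Complex.mul_conj, Complex.ofReal_re]
    rw [← h2, h1, Complex.re_sum]
    refine Finset.sum_congr rfl fun u _ => ?_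
    rw [Complex.re_sum]
    refine Finset.sum_congr rfl fun v _ => ?_
    rw [Complex.re_ofReal_mul]
  have hterm : ∀ u v, f u * f v * coulombSheetRaw L (u - v)
      = ∑ k, coulombSheetWeight L k / (L : ℝ) ^ 2 * (f u * f v * (torusPhase L k (u - v)).re) := by
    intro u v
    unfold coulombSheetRaw
    rw [Finset.sum_div, Finset.mul_sum]
    exact Finset.sum_congr rfl fun k _ => by ring
  have hswap : ∑ u, ∑ v, f u * f v * coulombSheetRaw L (u - v)
      = ∑ k, coulombSheetWeight L k / (L : ℝ) ^ 2 * ∑ u, ∑ v, f u * f v * (torusPhase L k (u - v)).re := by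
    calc ∑ u, ∑ v, f u * f v * coulombSheetRaw L (u - v)
        = ∑ u, ∑ v, ∑ k, coulombSheetWeight L k / (L : ℝ) ^ 2 * (f u * f v * (torusPhase L k (u - v)).re) :=
          Finset.sum_congr rfl fun u _ => Finset.sum_congr rfl fun v _ => hterm u v
      _ = ∑ u, ∑ k, ∑ v, coulombSheetWeight L k / (L : ℝ) ^ 2 * (f u * f v * (torusPhase L k (u - v)).re) :=
          Finset.sum_congr rfl fun u _ => Finset.sum_comm
      _ = ∑ k, ∑ u, ∑ v, coulombSheetWeight L k / (L : ℝ) ^ 2 * (f u * f v * (torusPhase L k (u - v)).re) :=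
          Finset.sum_comm
      _ = ∑ k, coulombSheetWeight L k / (L : ℝ) ^ 2 * ∑ u, ∑ v, f u * f v * (torusPhase L k (u - v)).re := by
          refine Finset.sum_congr rfl fun k _ => ?_
          rw [Finset.mul_sum]
          exact Finset.sum_congr rfl fun u _ => by rw [Finset.mul_sum]
  rw [hswap]
  refine Finset.sum_nonneg fun k _ => mul_nonneg (div_nonneg (coulombSheetWeight_nonneg k) (sq_nonneg _)) ?_
  rw [key k]
  exact Complex.normSq_nonneg _

/-- `W_L(0) = 0`. [folklore] -/
theorem coulombSheetKernel_zero (β : ℝ) : coulombSheetKernel L β 0 = 0 := by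
  unfold coulombSheetKernel; rw [if_pos rfl]

/-- `W_L` is even. [folklore] -/
theorem coulombSheetKernel_neg (β : ℝ) (z : TorusSite 2 L) : coulombSheetKernel L β (-z) = coulombSheetKernel L β z := by
  unfold coulombSheetKernel
  rw [coulombSheetRaw_neg]
  simp only [neg_eq_zero]

/-- `W_L ≥ 0` for `β ≥ 0`. [folklore] -/
theorem coulombSheetKernel_nonneg {β : ℝ} (hβ : 0 ≤ β) (z : TorusSite 2 L) : 0 ≤ coulombSheetKernel L β z := by
  unfold coulombSheetKernel
  split_ifs with hz
  · exact le_rfl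
  · have h := abs_coulombSheetRaw_le (L := L) z
    rw [abs_le] at h
    exact mul_nonneg hβ (by linarith [h.1])

/-- `W_L ≤ 50β` for `β ≥ 0`. [folklore] -/
theorem coulombSheetKernel_le {β : ℝ} (hβ : 0 ≤ β) (z : TorusSite 2 L) : coulombSheetKernel L β z ≤ 50 * β := by
  unfold coulombSheetKernel
  split_ifs with hz
  · linarith
  · have h := abs_coulombSheetRaw_le (L := L) z
    rw [abs_le] at h
    have hM := coulombSheetMass_le (L := L)
    nlinarith [h.2]

/-- **PSD of the Jastrow kernel with shift `50β` (PROVED, Parseval):** `Σ_{u,v} f_u f_v W_L(u−v) + 50β Σ f² ≥ 0`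
(`Σ f f W = β Q_V(f) + βV(0)(Σf)² − 2βV(0)Σf²`, `Q_V ≥ 0`, `V(0) ≤ 25`). [folklore] -/
theorem coulombSheetKernel_psd {β : ℝ} (hβ : 0 ≤ β) : KernelPSDShift (coulombSheetKernel L β) (50 * β) := by
  intro f
  have hM0 := coulombSheetMass_nonneg (L := L)
  have hM := coulombSheetMass_le (L := L)
  have hQ := coulombSheetRaw_psd (L := L) f
  have hdecomp : ∀ u v : TorusSite 2 L, f u * f v * coulombSheetKernel L β (u - v)
      = β * (f u * f v * coulombSheetRaw L (u - v)) + β * coulombSheetMass L * (f u * f v)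
        - (if u = v then 2 * β * coulombSheetMass L * f u ^ 2 else 0) := by
    intro u v
    unfold coulombSheetKernel
    by_cases h : u = v
    · subst h
      rw [sub_self, if_pos rfl, if_pos rfl, coulombSheetRaw_zero]
      ring
    · rw [if_neg (sub_ne_zero.mpr h), if_neg h]
      ring
  have hsum : ∑ u, ∑ v, f u * f v * coulombSheetKernel L β (u - v)
      = β * (∑ u, ∑ v, f u * f v * coulombSheetRaw L (u - v)) + β * coulombSheetMass L * (∑ u, f u) ^ 2
        - 2 * β * coulombSheetMass L * ∑ u, f u ^ 2 := by
    simp_rw [hdecomp, Finset.sum_sub_distrib, Finset.sum_add_distrib, Finset.sum_ite_eq, Finset.mem_univ, if_true,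
      ← Finset.mul_sum]
    rw [sq, Finset.sum_mul_sum]
    simp_rw [← Finset.mul_sum]
  rw [hsum]
  have hf2 : 0 ≤ ∑ u, f u ^ 2 := Finset.sum_nonneg fun u _ => sq_nonneg _
  nlinarith [mul_nonneg hβ hQ, mul_nonneg (mul_nonneg hβ hM0) (sq_nonneg (∑ u, f u)),
    mul_nonneg (mul_nonneg hβ (by linarith : (0 : ℝ) ≤ 25 - coulombSheetMass L)) hf2]

/-- **BEC OF THE HALF-FILLED COULOMB-SHEET JASTROW STATE — UNCONDITIONAL, EVERY `β ≥ 0`, EVERY `L ≥ 2`:**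
`n₀/|Λ| ≥ (⌊L²/2⌋/L²)(1 − ⌊L²/2⌋/L²)·exp(−C(β)/2)` with `C(β) = resamplingConst (50β) (50β)` independent of `L`. [folklore] -/
theorem condensateDensity_coulombSheet_ge {β : ℝ} (hβ : 0 ≤ β) (L : ℕ) [NeZero L] (hL : 2 ≤ L) :
    ((L ^ 2 / 2 : ℕ) / (L : ℝ) ^ 2) * (1 - (L ^ 2 / 2 : ℕ) / (L : ℝ) ^ 2)
        * Real.exp (-(resamplingConst (50 * β) (50 * β)) / 2)
      ≤ condensateDensity (jAmp (coulombSheetKernel L β) (L ^ 2 / 2)) := by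
  obtain ⟨h1, h2, h3⟩ := halfFilling_numerology L hL
  have hcard : (Fintype.card (TorusSite 2 L) : ℝ) = (L : ℝ) ^ 2 := by
    rw [Fintype.card_fun, ZMod.card, Fintype.card_fin]; push_cast; ring
  have h := condensateDensity_jAmp_ge_of_psd (coulombSheetKernel L β) (coulombSheetKernel_neg β)
    (coulombSheetKernel_zero β) (coulombSheetKernel_nonneg hβ) (coulombSheetKernel_le hβ) (L ^ 2 / 2) h1 h2 h3
    (by positivity : (0 : ℝ) ≤ 50 * β) (coulombSheetKernel_psd hβ)
  rw [hcard] at h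
  exact h

/-- **BEC OF THE HALF-FILLED COULOMB-SHEET JASTROW STATE on even tori (UNCONDITIONAL):** for every `β ≥ 0` and
every even `L ≥ 2`, `e^{−C(β)/2}/4 ≤ n₀/|Λ|`, `C(β) = resamplingConst (50β) (50β)` — a uniform, `L`-independent
condensate fraction for a 2D hard-core lattice Bose (Rokhsar–Kivelson) wavefunction with unscreened Coulomb-sheet
Jastrow correlations, reflection-positivity-free, at zero temperature. [folklore] -/
theorem condensateDensity_coulombSheet_ge_even {β : ℝ} (hβ : 0 ≤ β) (L : ℕ) [NeZero L] (hL : 2 ≤ L)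
    (hev : Even L) :
    Real.exp (-(resamplingConst (50 * β) (50 * β)) / 2) / 4
      ≤ condensateDensity (jAmp (coulombSheetKernel L β) (L ^ 2 / 2)) := by
  have key := condensateDensity_coulombSheet_ge hβ L hL
  rw [halfFilling_ratio_even L hL hev] at key
  have : (1 / 2 : ℝ) * (1 - 1 / 2) * Real.exp (-(resamplingConst (50 * β) (50 * β)) / 2)
      = Real.exp (-(resamplingConst (50 * β) (50 * β)) / 2) / 4 := by ring
  linarith [this ▸ key]

end CoulombSheet

end Summit.HubbardSuperconductivity.HubbardSuperconductivity.Theorems.AnisotropyChord.InsertionEntropy
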